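import Literature.Geometry.Riemannian.HeatKernelGaussianLemma
import Literature.Geometry.Riemannian.HeatKernelAprioriGaussianBound
import Literature.Geometry.Riemannian.ScalarCurvatureGradientBound
import Literature.Geometry.Riemannian.CurvatureFamilyBounds
import Literature.Geometry.Riemannian.PerelmanEntropyNoncollapsing
import Literature.Geometry.Riemannian.KernelNashEntropyW1Bound
import Literature.Geometry.Riemannian.UpperBallVolume
import HarnessLib

/-!
# Bamler's Gaussian heat kernel bound (Bamler 2020a, Thm. 7.2 = arXiv v1 Thm. 25)

R. Bamler, *Entropy and heat kernel bounds on a Ricci flow background*, arXiv:2008.07093 (2020a),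
§7.1 Thm. 7.2 and §7.3 (its proof from Lemma 7.x): for a Ricci flow of a smooth family of
Riemannian metrics on a closed connected `m`-manifold, `m ≥ 3`, times `a < s < t < T` with
`R ≥ R_min` on `M × [s, t]` and `−R_min (t − s) ≤ Λ`, and every `ε > 0`,

* `K(x,t;y,s) ≤ C(m,Λ,ε) (t−s)^{-m/2} e^{−𝒩*_s(x,t)} exp(−d_s(z,y)²/((8+ε)(t−s)))` for every
  `H_m`-centre `(z, s)` of `(x, t)`, and
* `K(x,t;y₁,s) K(x,t;y₂,s) ≤ C(m,Λ,ε) (t−s)^{-m} e^{−2𝒩*_s(x,t)} exp(−d_s(y₁,y₂)²/((8+ε)(t−s)))`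

(`exists_heatKernelFn_le_gaussian`). Proof as in the source: a flow-dependent Gaussian bound
(`exists_apriori_heatKernelFn_le_gaussian`, in place of the bound quoted from Chow et al.) starts
an induction over the constant `Z` driven by Lemma 7.x (`gaussianLemma`), which halves `Z` as
long as `Z ≥ Z̲(m, Λ, ε, 8 + ε)`. The source uses `𝒩* ≤ 0` to put the a-priori bound into the form
of hypothesis (7.14); here, instead, a flow-dependent uniform UPPER bound of the kernel Nash
entropy near the pole (`IsRicciFlow.exists_pointedNashEntropy_le`: Thm. 7.1 + concentration at an
`H_m`-centre + `Vol_s B(z, r) ≤ C r^m`) serves the same purpose, so the (not yet formalised)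
limit `lim_{τ→0} 𝒩 = 0` is not needed. Everything is proved; no definitions, no named facts.

## References

* R. H. Bamler, *Entropy and heat kernel bounds on a Ricci flow background*, arXiv:2008.07093
  (2020), §7.1 Thm. 7.2, §7.3 (proof of Thm. 7.2 from Lemma 7.x), (7.27)–(7.30).
  [Bamler2020Entropy]
-/

noncomputable section

open Set Filter Function MeasureTheory Measure Module
open scoped Manifold ContDiff Topology ENNReal NNReal

namespace Literature.Geometry.Riemannian

open Lorentzian Lorentzian.PseudoRiemannianMetric MetricFlow

/-! ### The induction over `Z` (pure real arithmetic) -/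

/-- **Descent by halving**: if `P` is monotone in `Z`, `P (2Z) → P Z` whenever `Z ≥ Z̲ > 0`, and
`P W` holds for some `W ≥ 0`, then `P (2 Z̲)` — the "induction over `Z`" of the source.
[cite: Bamler2020Entropy, §7.3, proof of Thm. 7.2 ("We can now use induction over Z")] -/
theorem descent_of_halving {P : ℝ → Prop} {Zb W : ℝ} (hZb : 0 < Zb) (hW : 0 ≤ W)
    (hmono : ∀ Z Z', P Z → Z ≤ Z' → P Z') (hstep : ∀ Z, Zb ≤ Z → P (2 * Z) → P Z) (hPW : P W) :
    P (2 * Zb) := by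
  -- `W ≤ 2^n (2 Z̲)` for some `n`, then induct on `n`
  have key : ∀ n : ℕ, ∀ W : ℝ, 0 ≤ W → W ≤ 2 ^ n * (2 * Zb) → P W → P (2 * Zb) := by
    intro n
    induction n with
    | zero =>
      intro W _ hWn hPW
      exact hmono W _ hPW (by simpa using hWn)
    | succ n ih =>
      intro W hW0 hWn hPW
      rcases le_or_gt W (2 * Zb) with hle | hgt
      · exact hmono W _ hPW hle
      · have hZ : Zb ≤ W / 2 := by linarith
        have hP2 : P (2 * (W / 2)) := by rwa [mul_div_cancel₀ W two_ne_zero]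
        have hP' : P (W / 2) := hstep (W / 2) hZ hP2
        refine ih (W / 2) (by linarith) ?_ hP'
        rw [pow_succ] at hWn
        rw [div_le_iff₀ (by norm_num : (0 : ℝ) < 2)]
        linarith
  obtain ⟨n, hn⟩ := pow_unbounded_of_one_lt (W / (2 * Zb)) (by norm_num : (1 : ℝ) < 2)
  have hWn : W ≤ 2 ^ n * (2 * Zb) := by
    rw [div_lt_iff₀ (by positivity)] at hn; exact hn.le
  exact key n W hW hWn hPW

/-! ### A flow-dependent uniform upper bound of the kernel Nash entropy near the pole -/

section Flow

variable {m : ℕ} {M : Type*} [TopologicalSpace M] [ChartedSpace (EuclideanSpace ℝ (Fin m)) M]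
  [IsManifold 𝓘(ℝ, EuclideanSpace ℝ (Fin m)) ∞ M] [T2Space M] [CompactSpace M]
  [SecondCountableTopology M] [MeasurableSpace M] [BorelSpace M] [ConnectedSpace M] [T3Space M]
  {h : ℝ → PseudoRiemannianMetric 𝓘(ℝ, EuclideanSpace ℝ (Fin m)) ∞ (EuclideanSpace ℝ (Fin m))
    (TangentSpace 𝓘(ℝ, EuclideanSpace ℝ (Fin m)) : M → Type _)}
  {cov : ℝ → CovariantDerivative 𝓘(ℝ, EuclideanSpace ℝ (Fin m)) (EuclideanSpace ℝ (Fin m))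
    (TangentSpace 𝓘(ℝ, EuclideanSpace ℝ (Fin m)) : M → Type _)}
  {a T : ℝ}

omit [SecondCountableTopology M] [MeasurableSpace M] [BorelSpace M] [ConnectedSpace M] [T3Space M] in
/-- **A lower scalar curvature bound on `M × [s, T]`** for a Ricci flow of a smooth family on a
closed manifold: `|Rm| ≤ K` on the compact `[s, T]`
(`IsContMDiffFamilyOn.exists_curvatureBoundedBy_of_isCompact`) gives `|R| ≤ m² K`
(`abs_scalarCurvatureWith_le_of_curvatureBoundedOn`). [cite: Topping2006, §5.3] -/
theorem IsRicciFlow.exists_le_scalarCurvatureWith (hflow : IsRicciFlow h cov (Icc a T))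
    (hR : ∀ r, (h r).IsRiemannian) {s : ℝ} (has : a ≤ s) :
    ∃ Rmin : ℝ, Rmin ≤ 0 ∧ ∀ r ∈ Icc s T, ∀ z : M, Rmin ≤ (h r).scalarCurvatureWith (cov r) z := by
  have hsub : Icc s T ⊆ Icc a T := Icc_subset_Icc_left has
  obtain ⟨K₀, hK₀⟩ := hflow.smooth.exists_curvatureBoundedBy_of_isCompact hflow.isLeviCivita
    isCompact_Icc hsub (fun r _ ↦ hR r)
  have hKnn : (0 : ℝ) ≤ max K₀ 0 := le_max_right _ _
  refine ⟨-((finrank ℝ (EuclideanSpace ℝ (Fin m)) : ℝ) ^ 2 * max K₀ 0),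
    neg_nonpos.2 (by positivity), fun r hr z ↦ ?_⟩
  have hcb : CurvatureBoundedBy (h r) (cov r) (max K₀ 0) := (hK₀ r hr).mono (le_max_left K₀ 0)
  have hb := abs_scalarCurvatureWith_le_of_curvatureBoundedOn (hR r)
    (curvatureBoundedOn_univ_iff.2 hcb) (mem_univ z)
  exact (abs_le.mp hb).1

set_option maxHeartbeats 800000 in
/-- **The kernel Nash entropy is bounded above near the pole, uniformly on a fixed flow**: for a
Ricci flow on `[a, T]` of a smooth family of Riemannian metrics on a closed connected manifold
modelled on `ℝᵐ`, `m ≥ 3`, and `a < s < T`, there is `E` (depending on the flow and on `s`) with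
`𝒩*_s(x, t) ≤ E` for all `x` and all `t ∈ (s, T)`. Proof: at an `H_m`-centre `(z, s)` of `(x, t)`
one has `ν_{x,t;s}(B_s(z, 2√(2H_m(t−s)))) ≥ 1/2` (`measure_setOf_sqrt_lt_le_half`), while
`K(x,t;·,s) ≤ C₇ (t−s)^{-m/2} e^{−𝒩*}` (Thm. 7.1,
`exists_heatKernelFn_le_rpow_mul_exp_neg_kernelNashEntropy`, with the lower scalar curvature
bound of the compact `[s, T]`) and `Vol_s B_s(z, r) ≤ C_v r^m` (`exists_riemVolume_ball_le_mul_pow`);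
hence `1/2 ≤ C₇ C_v (8 H_m)^{m/2} e^{−𝒩*}`. (The source has the sharper `𝒩* ≤ 0` from the
small-time asymptotics of the kernel, Prop. 5.2.) [cite: Bamler2020Entropy, §5.1 Prop. 5.2; §7.1 Thm. 7.1] -/
theorem IsRicciFlow.exists_pointedNashEntropy_le (hflow : IsRicciFlow h cov (Icc a T))
    (hh : IsContMDiffFamilyOn ∞ h univ) (hR : ∀ r, (h r).IsRiemannian) (hm : 3 ≤ m) {s : ℝ}
    (has : a < s) (hsT : s < T) :
    ∃ E : ℝ, ∀ ⦃t : ℝ⦄, s < t → t < T → ∀ x : M,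
      pointedNashEntropy h (fun r v ↦ hflow.heatKernelFn hh hR t x (v, r)) m t s ≤ E := by
  classical
  set Hm : ℝ := ((m : ℝ) - 1) * Real.pi ^ 2 / 2 + 4 with hHm
  have hm0 : 0 < m := by omega
  have hHm0 : 0 < Hm := by
    have h1 : (1 : ℝ) ≤ m := by exact_mod_cast hm0
    have : 0 ≤ ((m : ℝ) - 1) * Real.pi ^ 2 / 2 := by
      apply div_nonneg _ (by norm_num); exact mul_nonneg (by linarith) (sq_nonneg _)
    rw [hHm]; linarith
  -- lower scalar curvature bound on `[s, T]` and the resulting `Λ`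
  obtain ⟨Rmin, hRmin0, hRmin⟩ := hflow.exists_le_scalarCurvatureWith hR has.le
  set Λ : ℝ := -Rmin * (T - s) with hΛ
  have hΛ0 : 0 ≤ Λ := mul_nonneg (neg_nonneg.2 hRmin0) (by linarith)
  -- Thm 7.1 and the volume bound at time `s`
  obtain ⟨C₇, hC₇, H7⟩ := exists_heatKernelFn_le_rpow_mul_exp_neg_kernelNashEntropy m hm hΛ0
  obtain ⟨Cv, hCv, hvol⟩ := exists_riemVolume_ball_le_mul_pow (h s) (hR s)
  refine ⟨Real.log (2 * C₇ * Cv * (8 * Hm) ^ ((m : ℝ) / 2)), fun t hst htT x ↦ ?_⟩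
  set τ : ℝ := t - s with hτdef
  have hτ : 0 < τ := sub_pos.2 hst
  have ht : t ∈ Ioc a T := ⟨has.trans hst, htT.le⟩
  have hsI : s ∈ Icc a T := ⟨has.le, hsT.le⟩
  have htI : t ∈ Icc a T := ⟨ht.1.le, htT.le⟩
  set N : ℝ := pointedNashEntropy h (fun r v ↦ hflow.heatKernelFn hh hR t x (v, r)) m t s with hN
  -- an `H_m`-centre `z` of `(x, t)` at time `s`
  obtain ⟨z, hz⟩ := hflow.exists_lintegral_edist_sq_heatKernelMeasure_le hh hR hm0 hsI htI hst.le x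
  set ν : Measure M := heatKernelMeasure hh hR t x s with hν
  haveI : IsProbabilityMeasure ν := by rw [hν]; infer_instance
  have hdc : Continuous fun w ↦ (h s).edist (hR s) z w :=
    ((h s).continuous_edist (hR s)).comp (.prodMk_right z)
  -- concentration: `ν {2√(2 Hm τ) ≤ ... }`, i.e. the ball of radius `2A` has mass `≥ 1/2`
  set A : ℝ := Real.sqrt (2 * (Hm * τ)) with hA
  have hA0 : 0 < A := Real.sqrt_pos.2 (by positivity)
  have hconc : ν {w | ENNReal.ofReal A < (h s).edist (hR s) z w} ≤ 2⁻¹ :=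
    measure_setOf_sqrt_lt_le_half ν hdc (c := Hm * τ) (by simpa [hHm, hτdef] using hz)
  set B : Set M := {w | (h s).edist (hR s) z w < ENNReal.ofReal (2 * A)} with hB
  have hBmeas : MeasurableSet B := measurableSet_lt hdc.measurable measurable_const
  have hcompl : Bᶜ ⊆ {w | ENNReal.ofReal A < (h s).edist (hR s) z w} := by
    intro w hw
    simp only [hB, mem_compl_iff, mem_setOf_eq, not_lt] at hw
    exact lt_of_lt_of_le ((ENNReal.ofReal_lt_ofReal_iff (by positivity)).2 (by linarith)) hw
  have hνB : 2⁻¹ ≤ ν B := by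
    have h1 : ν Bᶜ ≤ 2⁻¹ := (measure_mono hcompl).trans hconc
    have h2 : ν B + ν Bᶜ = 1 := by rw [measure_add_measure_compl hBmeas, measure_univ]
    have h3 : (2⁻¹ : ℝ≥0∞) + 2⁻¹ ≤ ν B + 2⁻¹ := by
      calc (2⁻¹ : ℝ≥0∞) + 2⁻¹ = 1 := ENNReal.inv_two_add_inv_two
        _ = ν B + ν Bᶜ := h2.symm
        _ ≤ ν B + 2⁻¹ := add_le_add_right h1 _
    exact (ENNReal.add_le_add_iff_right (by simp)).1 h3
  -- `ν B ≤ C₇ τ^{-m/2} e^{-N} Vol_s(B) ≤ C₇ τ^{-m/2} e^{-N} Cv (2A)^m`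
  have hKle : ∀ w, hflow.heatKernelFn hh hR t x (w, s) ≤ C₇ * τ ^ (-(m : ℝ) / 2) * Real.exp (-N) :=
    fun w ↦ H7 hflow hh hR has hst htT (fun r hr z ↦ hRmin r ⟨hr.1, hr.2.trans htT.le⟩ z)
      (by rw [hΛ]; nlinarith [neg_nonneg.2 hRmin0, htT.le, hst.le]) x w
  set L : ℝ := C₇ * τ ^ (-(m : ℝ) / 2) * Real.exp (-N) with hL
  have hL0 : 0 ≤ L := by positivity
  have hνBle : ν B ≤ ENNReal.ofReal L * (h s).riemVolume B := by
    rw [hν, hflow.heatKernelMeasure_eq_withDensity_heatKernelFn hh hR ht x ⟨has, hst⟩,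
      withDensity_apply _ hBmeas]
    calc ∫⁻ w in B, ENNReal.ofReal (hflow.heatKernelFn hh hR t x (w, s)) ∂(h s).riemVolume
        ≤ ∫⁻ _w in B, ENNReal.ofReal L ∂(h s).riemVolume :=
          lintegral_mono fun w ↦ ENNReal.ofReal_le_ofReal (hKle w)
      _ = ENNReal.ofReal L * (h s).riemVolume B := by rw [setLIntegral_const, mul_comm]
  have hvolB : (h s).riemVolume B ≤ ENNReal.ofReal (Cv * (2 * A) ^ m) := by
    have hfin : (h s).riemVolume B ≠ ⊤ := (measure_lt_top_of_subset (subset_univ _)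
      (h s).riemVolume_univ_lt_top.ne).ne
    rw [← ENNReal.ofReal_toReal hfin]
    exact ENNReal.ofReal_le_ofReal (hvol z (2 * A) (by positivity))
  have hmain : (2⁻¹ : ℝ) ≤ L * (Cv * (2 * A) ^ m) := by
    have h1 : (2⁻¹ : ℝ≥0∞) ≤ ENNReal.ofReal (L * (Cv * (2 * A) ^ m)) := by
      calc (2⁻¹ : ℝ≥0∞) ≤ ν B := hνB
        _ ≤ ENNReal.ofReal L * (h s).riemVolume B := hνBle
        _ ≤ ENNReal.ofReal L * ENNReal.ofReal (Cv * (2 * A) ^ m) := by gcongr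
        _ = ENNReal.ofReal (L * (Cv * (2 * A) ^ m)) := by rw [ENNReal.ofReal_mul hL0]
    have h2 := ENNReal.toReal_mono ENNReal.ofReal_ne_top h1
    rwa [ENNReal.toReal_ofReal (by positivity), show (2⁻¹ : ℝ≥0∞).toReal = 2⁻¹ by norm_num]
      at h2
  -- `(2A)^m = (8 Hm)^{m/2} τ^{m/2}` and `τ^{m/2} τ^{-m/2} = 1`
  have hAm : (2 * A) ^ m = (8 * Hm) ^ ((m : ℝ) / 2) * τ ^ ((m : ℝ) / 2) := by
    have h2A : 0 ≤ 2 * A := by positivity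
    have hsq : (2 * A) ^ 2 = 8 * Hm * τ := by
      rw [mul_pow, hA, Real.sq_sqrt (by positivity)]; ring
    calc (2 * A) ^ m = ((2 * A) ^ (2 : ℝ)) ^ ((m : ℝ) / 2) := by
          rw [← Real.rpow_mul h2A, ← Real.rpow_natCast]; congr 1; ring
      _ = (8 * Hm * τ) ^ ((m : ℝ) / 2) := by rw [Real.rpow_two, hsq]
      _ = (8 * Hm) ^ ((m : ℝ) / 2) * τ ^ ((m : ℝ) / 2) := Real.mul_rpow (by positivity) hτ.le
  have hprod : L * (Cv * (2 * A) ^ m) = C₇ * Cv * (8 * Hm) ^ ((m : ℝ) / 2) * Real.exp (-N) := by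
    rw [hL, hAm]
    have e : τ ^ (-(m : ℝ) / 2) * τ ^ ((m : ℝ) / 2) = 1 := by
      rw [← Real.rpow_add hτ, show -(m : ℝ) / 2 + (m : ℝ) / 2 = 0 by ring, Real.rpow_zero]
    calc C₇ * τ ^ (-(m : ℝ) / 2) * Real.exp (-N) * (Cv * ((8 * Hm) ^ ((m : ℝ) / 2) * τ ^ ((m : ℝ) / 2)))
        = C₇ * Cv * (8 * Hm) ^ ((m : ℝ) / 2) * Real.exp (-N) *
            (τ ^ (-(m : ℝ) / 2) * τ ^ ((m : ℝ) / 2)) := by ring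
      _ = _ := by rw [e, mul_one]
  rw [hprod] at hmain
  -- conclude: `e^{N} ≤ 2 C₇ Cv (8 Hm)^{m/2}`
  have hD0 : 0 < C₇ * Cv * (8 * Hm) ^ ((m : ℝ) / 2) := by positivity
  have hexp : Real.exp N ≤ 2 * C₇ * Cv * (8 * Hm) ^ ((m : ℝ) / 2) := by
    have h1 : Real.exp N * 2⁻¹ ≤ Real.exp N * (C₇ * Cv * (8 * Hm) ^ ((m : ℝ) / 2) * Real.exp (-N)) :=
      mul_le_mul_of_nonneg_left hmain (Real.exp_pos _).le
    rw [show Real.exp N * (C₇ * Cv * (8 * Hm) ^ ((m : ℝ) / 2) * Real.exp (-N)) =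
      C₇ * Cv * (8 * Hm) ^ ((m : ℝ) / 2) * (Real.exp N * Real.exp (-N)) by ring,
      ← Real.exp_add, add_neg_cancel, Real.exp_zero, mul_one] at h1
    linarith
  calc N = Real.log (Real.exp N) := (Real.log_exp N).symm
    _ ≤ Real.log (2 * C₇ * Cv * (8 * Hm) ^ ((m : ℝ) / 2)) :=
        Real.log_le_log (Real.exp_pos _) hexp

end Flow

/-! ### Theorem 7.2 -/

set_option maxHeartbeats 1600000 in
/-- **Bamler 2020a, Thm. 7.2 (arXiv v1 Thm. 25): the Gaussian upper bound of the heat kernel.**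
For `m ≥ 3`, `Λ ≥ 0` and `ε > 0` there is `C > 0` such that for every Ricci flow on `[a,T]` of a
smooth family of Riemannian metrics on a closed connected manifold modelled on `ℝᵐ`, all
`a < s < t < T` with `R ≥ R_min` on `M × [s,t]` and `−R_min(t−s) ≤ Λ`:
(i) `K(x,t;y,s) ≤ C (t−s)^{-m/2} e^{−𝒩*_s(x,t)} exp(−d_s(z,y)²/((8+ε)(t−s)))` for every
`H_m`-centre `(z, s)` of `(x, t)` (kernel form `∫ d_s(z,·)² dν_{x,t;s} ≤ H_m (t−s)`), and
(ii) `K(x,t;y₁,s) K(x,t;y₂,s) ≤ C (t−s)^{-m} e^{−2𝒩*_s(x,t)} exp(−d_s(y₁,y₂)²/((8+ε)(t−s)))`.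
Proof (§7.3 of the source, at general scale): with `s` fixed, let `P(Q, Z)` be the Gaussian
bound with constants `(Q, Z)` at all `t' ∈ (s, t]`; the a-priori bound
`exists_apriori_heatKernelFn_le_gaussian` and the uniform entropy bound
`IsRicciFlow.exists_pointedNashEntropy_le` give `P(Q*, Z*)` for flow-dependent `Q*, Z*`;
Lemma 7.x (`gaussianLemma`) turns `P(Q, 2Z)`, `Z ≥ Z̲(Q)`, into `P(8+ε, Z)`; one application with
`Q = Q*` and the descent `descent_of_halving` with `Q = 8 + ε` yield `P(8+ε, 2Z̲(8+ε))`, and a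
last application of Lemma 7.x gives (ii). `C = 2 Z̲(m, Λ, ε, 8+ε)`.
[cite: Bamler2020Entropy, §7.1 Thm. 7.2; §7.3, proof of Thm. 7.2] -/
theorem exists_heatKernelFn_le_gaussian (m : ℕ) (hm : 3 ≤ m) {Λ ε : ℝ} (hΛ : 0 ≤ Λ) (hε : 0 < ε) :
    ∃ C : ℝ, 0 < C ∧ ∀ {M : Type*} [TopologicalSpace M]
      [ChartedSpace (EuclideanSpace ℝ (Fin m)) M]
      [IsManifold 𝓘(ℝ, EuclideanSpace ℝ (Fin m)) ∞ M] [T2Space M] [CompactSpace M]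
      [SecondCountableTopology M] [MeasurableSpace M] [BorelSpace M] [ConnectedSpace M] [T3Space M]
      {h : ℝ → PseudoRiemannianMetric 𝓘(ℝ, EuclideanSpace ℝ (Fin m)) ∞ (EuclideanSpace ℝ (Fin m))
        (TangentSpace 𝓘(ℝ, EuclideanSpace ℝ (Fin m)) : M → Type _)}
      {cov : ℝ → CovariantDerivative 𝓘(ℝ, EuclideanSpace ℝ (Fin m)) (EuclideanSpace ℝ (Fin m))
        (TangentSpace 𝓘(ℝ, EuclideanSpace ℝ (Fin m)) : M → Type _)}
      {a T : ℝ} (hflow : IsRicciFlow h cov (Icc a T)) (hh : IsContMDiffFamilyOn ∞ h univ)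
      (hR : ∀ r, (h r).IsRiemannian),
      ∀ {s t : ℝ}, a < s → s < t → t < T → ∀ {Rmin : ℝ},
      (∀ r ∈ Icc s t, ∀ z : M, Rmin ≤ (h r).scalarCurvatureWith (cov r) z) →
      -Rmin * (t - s) ≤ Λ →
      (∀ x y z : M,
        ∫⁻ w, (h s).edist (hR s) z w ^ 2 ∂(heatKernelMeasure hh hR t x s) ≤
          ENNReal.ofReal ((((m : ℝ) - 1) * Real.pi ^ 2 / 2 + 4) * (t - s)) →
        hflow.heatKernelFn hh hR t x (y, s) ≤
          C * (t - s) ^ (-(m : ℝ) / 2) *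
            Real.exp (-(pointedNashEntropy h (fun r v ↦ hflow.heatKernelFn hh hR t x (v, r)) m t s)) *
            Real.exp (-((h s).edist (hR s) z y).toReal ^ 2 / ((8 + ε) * (t - s)))) ∧
      (∀ x y₁ y₂ : M,
        hflow.heatKernelFn hh hR t x (y₁, s) * hflow.heatKernelFn hh hR t x (y₂, s) ≤
          C * (t - s) ^ (-(m : ℝ)) *
            Real.exp (-2 * pointedNashEntropy h (fun r v ↦ hflow.heatKernelFn hh hR t x (v, r)) m t s) *
            Real.exp (-((h s).edist (hR s) y₁ y₂).toReal ^ 2 / ((8 + ε) * (t - s)))) := by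
  classical
  have h8 : 0 < 8 + ε := by linarith
  obtain ⟨Zb, hZb, GL8⟩ := gaussianLemma m hm hΛ hε h8
  refine ⟨2 * Zb, by positivity, ?_⟩
  intro M _ _ _ _ _ _ _ _ _ _ h cov a T hflow hh hR s t has hst htT Rmin hRmin hRΛ
  have hsT : s < T := hst.trans htT
  -- normalised lower scalar curvature bound `Rm ≤ 0` on `[s, t]`
  set Rm : ℝ := min Rmin 0 with hRm
  have hRm' : ∀ r ∈ Icc s t, ∀ z : M, Rm ≤ (h r).scalarCurvatureWith (cov r) z :=
    fun r hr z ↦ (min_le_left _ _).trans (hRmin r hr z)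
  have hRmΛ : ∀ t' ∈ Ioc s t, -Rm * (t' - s) ≤ Λ := by
    intro t' ht'
    have h1 : 0 ≤ -Rm := neg_nonneg.2 (min_le_right _ _)
    have h2 : -Rm * (t' - s) ≤ -Rm * (t - s) :=
      mul_le_mul_of_nonneg_left (by linarith [ht'.2]) h1
    refine h2.trans ?_
    rcases le_total Rmin 0 with hR0 | hR0
    · rw [hRm, min_eq_left hR0]; exact hRΛ
    · rw [hRm, min_eq_right hR0]; simp [hΛ]
  -- the predicate `P Q Z`
  set P : ℝ → ℝ → Prop := fun Q Z ↦ ∀ t' ∈ Ioc s t, ∀ x y z : M,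
      ∫⁻ w, (h s).edist (hR s) z w ^ 2 ∂(heatKernelMeasure hh hR t' x s) ≤
        ENNReal.ofReal ((((m : ℝ) - 1) * Real.pi ^ 2 / 2 + 4) * (t' - s)) →
      hflow.heatKernelFn hh hR t' x (y, s) ≤
        Z * (t' - s) ^ (-(m : ℝ) / 2) *
          Real.exp (-(pointedNashEntropy h (fun r v ↦ hflow.heatKernelFn hh hR t' x (v, r)) m t' s)) *
          Real.exp (-((h s).edist (hR s) z y).toReal ^ 2 / (Q * (t' - s))) with hP
  -- monotonicity in `Z`
  have hmono : ∀ Q Z Z', P Q Z → Z ≤ Z' → P Q Z' := by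
    intro Q Z Z' hPZ hZZ' t' ht' x y z hz
    have h1 := hPZ t' ht' x y z hz
    refine h1.trans ?_
    have : 0 ≤ (t' - s) ^ (-(m : ℝ) / 2) *
        Real.exp (-(pointedNashEntropy h (fun r v ↦ hflow.heatKernelFn hh hR t' x (v, r)) m t' s)) *
        Real.exp (-((h s).edist (hR s) z y).toReal ^ 2 / (Q * (t' - s))) := by
      have : 0 ≤ (t' - s) ^ (-(m : ℝ) / 2) := Real.rpow_nonneg (sub_pos.2 ht'.1).le _
      positivity
    nlinarith [this]
  -- one step of Lemma 7.x at every `t' ∈ (s, t]`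
  have hstep_of : ∀ {Q Zq : ℝ},
      (∀ {s' t'' : ℝ}, a < s' → s' < t'' → t'' < T → ∀ {Rmin' : ℝ},
        (∀ r ∈ Icc s' t'', ∀ z : M, Rmin' ≤ (h r).scalarCurvatureWith (cov r) z) →
        -Rmin' * (t'' - s') ≤ Λ → ∀ {Z : ℝ}, Zq ≤ Z →
        (∀ t' ∈ Ioc s' ((s' + t'') / 2), ∀ x' y' z' : M,
          ∫⁻ w, (h s').edist (hR s') z' w ^ 2 ∂(heatKernelMeasure hh hR t' x' s') ≤
            ENNReal.ofReal ((((m : ℝ) - 1) * Real.pi ^ 2 / 2 + 4) * (t' - s')) →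
          hflow.heatKernelFn hh hR t' x' (y', s') ≤
            2 * Z * (t' - s') ^ (-(m : ℝ) / 2) *
              Real.exp (-(pointedNashEntropy h (fun r v ↦ hflow.heatKernelFn hh hR t' x' (v, r)) m t' s')) *
              Real.exp (-((h s').edist (hR s') z' y').toReal ^ 2 / (Q * (t' - s')))) →
        (∀ x y z : M,
          ∫⁻ w, (h s').edist (hR s') z w ^ 2 ∂(heatKernelMeasure hh hR t'' x s') ≤
            ENNReal.ofReal ((((m : ℝ) - 1) * Real.pi ^ 2 / 2 + 4) * (t'' - s')) →
          hflow.heatKernelFn hh hR t'' x (y, s') ≤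
            Z * (t'' - s') ^ (-(m : ℝ) / 2) *
              Real.exp (-(pointedNashEntropy h (fun r v ↦ hflow.heatKernelFn hh hR t'' x (v, r)) m t'' s')) *
              Real.exp (-((h s').edist (hR s') z y).toReal ^ 2 / ((8 + ε) * (t'' - s')))) ∧
        (∀ x y₁ y₂ : M,
          hflow.heatKernelFn hh hR t'' x (y₁, s') * hflow.heatKernelFn hh hR t'' x (y₂, s') ≤
            Z * (t'' - s') ^ (-(m : ℝ)) *
              Real.exp (-2 * pointedNashEntropy h (fun r v ↦ hflow.heatKernelFn hh hR t'' x (v, r)) m t'' s') *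
              Real.exp (-((h s').edist (hR s') y₁ y₂).toReal ^ 2 / ((8 + ε) * (t'' - s'))))) →
      ∀ Z, Zq ≤ Z → P Q (2 * Z) → P (8 + ε) Z := by
    intro Q Zq Hgl Z hZ hP2 t' ht' x y z hz
    have ht'T : t' < T := lt_of_le_of_lt ht'.2 htT
    refine (Hgl has ht'.1 ht'T (Rmin' := Rm) (fun r hr w ↦ hRm' r ⟨hr.1, hr.2.trans ht'.2⟩ w)
      (hRmΛ t' ht') hZ ?_).1 x y z hz
    intro t'' ht'' x' y' z' hz'
    have ht''t : t'' ∈ Ioc s t := ⟨ht''.1, by linarith [ht''.2, ht'.1, ht'.2]⟩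
    exact hP2 t'' ht''t x' y' z' hz'
  have hstep8 : ∀ Z, Zb ≤ Z → P (8 + ε) (2 * Z) → P (8 + ε) Z :=
    hstep_of (fun {s' t''} hs' hst' ht''T {Rmin'} hR1 hR2 {Z} hZ HYP ↦
      GL8 hflow hh hR hs' hst' ht''T hR1 hR2 hZ HYP)
  /- ── the start: a flow-dependent `P Q* Z₀` ── -/
  have hsub : Icc s T ⊆ Icc a T := Icc_subset_Icc_left has.le
  obtain ⟨K₀, hK₀⟩ := hflow.smooth.exists_curvatureBoundedBy_of_isCompact hflow.isLeviCivita
    isCompact_Icc hsub (fun r _ ↦ hR r)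
  set Kc : ℝ := max K₀ 0 with hKc
  have hKc0 : 0 ≤ Kc := le_max_right _ _
  have hcurv : ∀ r ∈ Icc s T, CurvatureBoundedBy (h r) (cov r) Kc := fun r hr ↦
    (hK₀ r hr).mono (le_max_left _ _)
  obtain ⟨Λ', hΛ'0, hdR⟩ := exists_gradSq_scalarCurvature_le hflow (fun r _ ↦ hR r)
    isCompact_Icc hsub
  obtain ⟨Zs, Qs, hZs, hQs, hAP⟩ :=
    exists_apriori_heatKernelFn_le_gaussian hflow hh hR hm has hsT hKc0 hΛ'0 hcurv hdR
  obtain ⟨E, hE⟩ := hflow.exists_pointedNashEntropy_le hh hR hm has hsT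
  have hstart : P Qs (Zs * Real.exp E) := by
    intro t' ht' x y z hz
    have ht'T : t' < T := lt_of_le_of_lt ht'.2 htT
    have h1 := hAP ht'.1 ht'T.le x y z hz
    have hN := hE ht'.1 ht'T x
    set N' : ℝ := pointedNashEntropy h (fun r v ↦ hflow.heatKernelFn hh hR t' x (v, r)) m t' s
    have h2 : (1 : ℝ) ≤ Real.exp E * Real.exp (-N') := by
      rw [← Real.exp_add]; exact Real.one_le_exp (by linarith)
    have hfac : 0 ≤ Zs * (t' - s) ^ (-(m : ℝ) / 2) *
        Real.exp (-((h s).edist (hR s) z y).toReal ^ 2 / (Qs * (t' - s))) := by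
      have : 0 ≤ (t' - s) ^ (-(m : ℝ) / 2) := Real.rpow_nonneg (sub_pos.2 ht'.1).le _
      positivity
    calc hflow.heatKernelFn hh hR t' x (y, s)
        ≤ Zs * (t' - s) ^ (-(m : ℝ) / 2) *
            Real.exp (-((h s).edist (hR s) z y).toReal ^ 2 / (Qs * (t' - s))) := h1
      _ = (Zs * (t' - s) ^ (-(m : ℝ) / 2) *
            Real.exp (-((h s).edist (hR s) z y).toReal ^ 2 / (Qs * (t' - s)))) * 1 := (mul_one _).symm
      _ ≤ (Zs * (t' - s) ^ (-(m : ℝ) / 2) *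
            Real.exp (-((h s).edist (hR s) z y).toReal ^ 2 / (Qs * (t' - s)))) *
            (Real.exp E * Real.exp (-N')) := mul_le_mul_of_nonneg_left h2 hfac
      _ = Zs * Real.exp E * (t' - s) ^ (-(m : ℝ) / 2) * Real.exp (-N') *
            Real.exp (-((h s).edist (hR s) z y).toReal ^ 2 / (Qs * (t' - s))) := by ring
  /- ── from `Q*` to `8 + ε`, then the descent ── -/
  obtain ⟨ZbQ, hZbQ, GLQ⟩ := gaussianLemma m hm hΛ hε hQs
  have hstepQ : ∀ Z, ZbQ ≤ Z → P Qs (2 * Z) → P (8 + ε) Z :=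
    hstep_of (fun {s' t''} hs' hst' ht''T {Rmin'} hR1 hR2 {Z} hZ HYP ↦
      GLQ hflow hh hR hs' hst' ht''T hR1 hR2 hZ HYP)
  set Z₀ : ℝ := max (Zs * Real.exp E / 2) ZbQ with hZ₀
  have hZ₀0 : 0 ≤ Z₀ := hZbQ.le.trans (le_max_right _ _)
  have hP0 : P (8 + ε) Z₀ := by
    refine hstepQ Z₀ (le_max_right _ _) (hmono Qs _ _ hstart ?_)
    have : Zs * Real.exp E / 2 ≤ Z₀ := le_max_left _ _
    linarith
  have hPfin : P (8 + ε) (2 * Zb) :=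
    descent_of_halving (P := P (8 + ε)) hZb hZ₀0 (hmono (8 + ε)) hstep8 hP0
  /- ── conclusions ── -/
  have htI : t ∈ Ioc s t := ⟨hst, le_rfl⟩
  refine ⟨fun x y z hz ↦ hPfin t htI x y z hz, fun x y₁ y₂ ↦ ?_⟩
  have hZbZb : Zb ≤ Zb := le_rfl
  have h2 := (GL8 hflow hh hR has hst htT hRm' (hRmΛ t htI) hZbZb (fun t'' ht'' x' y' z' hz' ↦
    hPfin t'' ⟨ht''.1, by linarith [ht''.2, hst]⟩ x' y' z' hz')).2 x y₁ y₂
  refine h2.trans ?_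
  have hτ : 0 < t - s := sub_pos.2 hst
  have hfac : 0 ≤ (t - s) ^ (-(m : ℝ)) *
      Real.exp (-2 * pointedNashEntropy h (fun r v ↦ hflow.heatKernelFn hh hR t x (v, r)) m t s) *
      Real.exp (-((h s).edist (hR s) y₁ y₂).toReal ^ 2 / ((8 + ε) * (t - s))) := by
    have : 0 ≤ (t - s) ^ (-(m : ℝ)) := Real.rpow_nonneg hτ.le _
    positivity
  nlinarith [hfac, hZb]

end Literature.Geometry.Riemannian

end
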